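import Summits.RiemannHypothesis.RiemannHypothesis.Theorems.WeilFormatCPolyWindowEntryBox
import HarnessLib

/-!
# Format C, design C∞ (E2e, data side): boxes of the composed Gram quadratic form `Q = Aᵀ·Hmid·A + Aᵀ·diag(c)·A`

Route context: Fourier–Galerkin / Schur-complement certificates of Weil positivity on a window ("format C", C∞ door;
cell memo `run/shared/lean/pub/rh-explicit/rh-explicit-weil-2/gen15/E2-PLAN-v2.md` §6.9; supporting stmt-RiemannHypothesis-0098;
seat rh-explicit-weil-2).  In the door's `hUqe'`, `Γe(u(z))` with `u = A·z` (`A_{(t,e),k}` = rescaled collected coefficients minus the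
free-map correction — real numbers known through the E2b boxes) is rewritten by `gramMajorant_comp_linear` (`WeilFormatCCinfGramData`) as
`zᵀQz`, `Q_{kk'} = Σ_{(t,e),(t',e')} A_{(t,e)k} A_{(t',e')k'} Hmid(t,t',e+e'+2) + Σ_{(t,e)} c_{(t,e)} A_{(t,e)k} A_{(t,e)k'}`, and
`quadForm_le_of_boxes` (`WeilFormatCCinfDomination`) replaces `Q` by a rational `M` given ENTRYWISE BOXES of `Q`.  This file is the
kernel evaluator of those boxes and the index bookkeeping:

* `CinfCoeff.quadEntryBox S A Hm c D k k' ∋ Q_{kk'}` from boxes `A t e k ∋ a(t,e,k)` (`t < 4`, `e < D`) and RATIONAL `Hm`, `c`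
  (`mem_quadEntryBox`; `16·D²` products per entry — the largest kernel item of E2, split by row blocks);
* `CinfCoeff.sum_prod_fin_eq_sum_range₂` — `Σ_{p : Fin 4 × Fin D} g p = Σ_{t<4} Σ_{e<D} G t e` (the family-indexed sums of the glue
  lemmas as the range sums the evaluator computes).

Interval plumbing only; standard axioms; no RH claim.
-/

set_option autoImplicit false
-- `Summit.RiemannHypothesis.RiemannHypothesis.…` is the layout-mandated namespace (summit = problem name).
set_option linter.dupNamespace false

namespace Summit.RiemannHypothesis.RiemannHypothesis.Theorems.WeilFormatC

open Literature.Analysis.ValidatedNumerics Literature.Analysis.ValidatedNumerics.NumericsMP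

namespace CinfCoeff

open WinConst (mulRatBox mem_mulRatBox)
open WinEntry (sumBox mem_sumBox)

variable {S : ℕ}

/-! ## Index bookkeeping -/

/-- `Σ_{p : Fin 4 × Fin D} g p = Σ_{t<4} Σ_{e<D} G t e` whenever `G` agrees with `g` on valid indices. -/
theorem sum_prod_fin_eq_sum_range₂ {D : ℕ} (g : Fin 4 × Fin D → ℝ) (G : ℕ → ℕ → ℝ)
    (hG : ∀ (t : Fin 4) (e : Fin D), G t e = g (t, e)) :
    ∑ p : Fin 4 × Fin D, g p = ∑ t ∈ Finset.range 4, ∑ e ∈ Finset.range D, G t e := by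
  rw [Fintype.sum_prod_type, ← Fin.sum_univ_eq_sum_range]
  refine Finset.sum_congr rfl fun t _ ↦ ?_
  rw [← Fin.sum_univ_eq_sum_range]
  exact Finset.sum_congr rfl fun e _ ↦ (hG t e).symm

/-! ## The entry evaluator -/

/-- **Box of `Q_{kk'}`** (see the module doc): four nested range sums of `A·A·Hm` plus the diagonal-weight term. -/
def quadEntryBox (S : ℕ) (A : ℕ → ℕ → ℕ → MI) (Hm : ℕ → ℕ → ℕ → ℚ) (c : ℕ → ℕ → ℚ) (D k k' : ℕ) : MI :=
  (sumBox S (fun t ↦ sumBox S (fun e ↦ sumBox S (fun t' ↦ sumBox S (fun e' ↦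
      mulRatBox (MI.mul S (A t e k) (A t' e' k')) (Hm t t' (e + e' + 2))) D) 4) D) 4).add
    (sumBox S (fun t ↦ sumBox S (fun e ↦ mulRatBox (MI.mul S (A t e k) (A t e k')) (c t e)) D) 4)

/-- **`quadEntryBox ∋ Q_{kk'}`.** -/
theorem mem_quadEntryBox (hS : 0 < S) {D : ℕ} {a : ℕ → ℕ → ℕ → ℝ} {A : ℕ → ℕ → ℕ → MI}
    (hA : ∀ t < 4, ∀ e < D, ∀ k, MI.mem S (a t e k) (A t e k)) (Hm : ℕ → ℕ → ℕ → ℚ) (c : ℕ → ℕ → ℚ)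
    (k k' : ℕ) :
    MI.mem S ((∑ t ∈ Finset.range 4, ∑ e ∈ Finset.range D, ∑ t' ∈ Finset.range 4, ∑ e' ∈ Finset.range D,
        a t e k * a t' e' k' * (Hm t t' (e + e' + 2) : ℝ))
      + ∑ t ∈ Finset.range 4, ∑ e ∈ Finset.range D, (c t e : ℝ) * a t e k * a t e k')
      (quadEntryBox S A Hm c D k k') := by
  unfold quadEntryBox
  refine MI.mem_add ?_ ?_
  · refine mem_sumBox 4 fun t ht ↦ mem_sumBox D fun e he ↦ mem_sumBox 4 fun t' ht' ↦ mem_sumBox D fun e' he' ↦ ?_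
    exact mem_mulRatBox (MI.mem_mul hS (hA t ht e he k) (hA t' ht' e' he' k')) _
  · refine mem_sumBox 4 fun t ht ↦ mem_sumBox D fun e he ↦ ?_
    have h := mem_mulRatBox (MI.mem_mul hS (hA t ht e he k) (hA t ht e he k')) (c t e)
    have e1 : a t e k * a t e k' * ((c t e : ℚ) : ℝ) = (c t e : ℝ) * a t e k * a t e k' := by ring
    rw [e1] at h
    exact h

/-- The composed form of `gramMajorant_comp_linear` in range-sum shape: with `G t t' e e' := Hmid` Hankel in `e+e'+2` and the
diagonal weights `c`, `Σ_{p,p'} A_{pk}A_{p'k'}Hmid(p.1,p'.1,p.2+p'.2+2) + Σ_p c_p A_{pk}A_{pk'}` equals the range expression enclosed by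
`quadEntryBox` (pure reindexing; `a`/`cc` agree with the `Fin`-indexed data on valid indices). -/
theorem quadEntry_eq_range {D : ℕ} (Af : Fin 4 × Fin D → ℕ → ℝ) (a : ℕ → ℕ → ℕ → ℝ)
    (ha : ∀ (t : Fin 4) (e : Fin D) (k : ℕ), a t e k = Af (t, e) k)
    (Hmid : Fin 4 → Fin 4 → ℕ → ℝ) (Hm : ℕ → ℕ → ℕ → ℚ)
    (hH : ∀ (t t' : Fin 4) (s : ℕ), (Hm t t' s : ℝ) = Hmid t t' s)
    (cf : Fin 4 × Fin D → ℝ) (c : ℕ → ℕ → ℚ) (hc : ∀ (t : Fin 4) (e : Fin D), (c t e : ℝ) = cf (t, e)) (k k' : ℕ) :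
    (∑ p : Fin 4 × Fin D, ∑ p' : Fin 4 × Fin D, Af p k * Af p' k' * Hmid p.1 p'.1 ((p.2 : ℕ) + (p'.2 : ℕ) + 2))
      + ∑ p : Fin 4 × Fin D, cf p * Af p k * Af p k'
      = (∑ t ∈ Finset.range 4, ∑ e ∈ Finset.range D, ∑ t' ∈ Finset.range 4, ∑ e' ∈ Finset.range D,
          a t e k * a t' e' k' * (Hm t t' (e + e' + 2) : ℝ))
        + ∑ t ∈ Finset.range 4, ∑ e ∈ Finset.range D, (c t e : ℝ) * a t e k * a t e k' := by
  congr 1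
  · rw [sum_prod_fin_eq_sum_range₂ _ (fun t e ↦ ∑ t' ∈ Finset.range 4, ∑ e' ∈ Finset.range D,
        a t e k * a t' e' k' * (Hm t t' (e + e' + 2) : ℝ))]
    intro t e
    rw [sum_prod_fin_eq_sum_range₂ _ (fun t' e' ↦ a t e k * a t' e' k' * (Hm t t' (e + e' + 2) : ℝ))]
    intro t' e'
    rw [ha, ha, hH]
  · rw [sum_prod_fin_eq_sum_range₂ _ (fun t e ↦ (c t e : ℝ) * a t e k * a t e k')]
    intro t e
    rw [ha, ha, hc]

end CinfCoeff

end Summit.RiemannHypothesis.RiemannHypothesis.Theorems.WeilFormatC
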